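import Literature.AlgebraicGeometry.Deligne1982.WeilTypeCMGeneralMemberWeilClassesNotLefschetz
import Literature.AlgebraicGeometry.Milne1999.SpecialLefschetzGroupInvariantsHodgeClasses
import HarnessLib

/-!
# The divisor classes of the general CM-Weil abelian variety: `B¹ ⊗ ℂ = ⊕_β ℂ · Σᵢ w^β_i ∧ w*^β_i`, `ρ(A) = [F:ℚ]`

For a general polarized abelian variety `(A, η, h)` of Weil type relative to the CM field `E = ℚ(η)` (`Hg(A) = SU(φ)`,
tree `HasHodgeGroupSUCM`; `[E:ℚ] = 2e₀`, `F` the totally real subfield, `[F:ℚ] = e₀`; `dim_E H¹(A, ℚ) = 2k` with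
`k ≥ 2`), the degree-one Hodge classes are computed in the Weil basis `w^β_i ∈ W_β`, `w*^β_i ∈ W'_β` of
`H¹(A(ℂ); ℂ)` (tree `weilBasisN`): `B¹ ⊗ ℂ = (⋀² H¹)^{SU(φ)(ℂ)}` is spanned by the pairings
`D'_β = Σᵢ w^β_i ∧ w*^β_i`, one for each embedding `β` of the CM type, and these are linearly independent; hence
`dim_ℚ B¹(A) = dim_ℂ B¹ ⊗ ℂ = e₀ = [F:ℚ]` — the Picard number of the general member. This is the degree-one line of
Weil's / van Geemen's invariant count («`dim_ℚ Bᵖ(X) = dim_ℂ ((⋀^{2p}V) ⊗ ℂ)^{SL_{2n}(ℂ)}` … `dim B¹(X) = 1`» for `E`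
imaginary quadratic, [vanGeemen1994HodgeAV, Thm. 6.12 and its proof]; «the same argument works in general»,
[Deligne1982HodgeCycles, Milne's endnote 16]), and agrees with `NS(A) ⊗ ℚ ≅ End⁰(A)^{sym} = F` for `End⁰(A) = E` with
the Rosati involution inducing complex conjugation ([MumfordAV1970, §21 Application III]; [LangeBirkenhake1992,
Prop. 5.2.1]; `End⁰(A) = E` for the general member is Milne's `L(A) = GU(φ)` [Milne2025AbelianMotivesCharP, Ex. 1.17],
tree `WeilTypeCMGeneralMemberEndomorphismField`).

## What is proved (all `theorem`s; no definition, no named fact; `k ≥ 2` where stated)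

* §1 the signed block transposition `swapCM β x y ∈ SU(φ)(ℂ)` (tree) on the Weil vectors and on the pair monomials:
  `swapCM_weilVec_left/right/of_ne/of_block_ne`, **`extAct_swapCM_monB_pairIdxN`** (it permutes the pair monomials of
  block `β` by the transposition `(x y)` and fixes the others — with sign `+1`).
* §2 **`IsWeilTypeCM.repr_pairIdxN_eq_of_mem_hodgeClassSpan_one`**: the pair coefficients of a class of `B¹ ⊗ ℂ` are
  constant in each block (transposition invariance); **`IsWeilTypeCM.eq_sum_smul_sum_monB_pairIdxN`**
  (`x = Σ_β a_β D'_β`); **`IsWeilTypeCM.hodgeClassSpan_one_le_span_sum_monB_pairIdxN`**.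
* §3 **`IsWeilTypeCM.sum_monB_pairIdxN_mem_hodgeClassSpan_one`** (`D'_β ∈ B¹ ⊗ ℂ`: it is `α_β⁻¹ · D'_β(h)` for the
  paired part of the polarization, tree `pairPart_mem_hodgeClassSpan`, `repr_pairIdxN_ne_zero`);
  **`IsWeilTypeCM.hodgeClassSpan_one_eq_span_sum_monB_pairIdxN`** (`B¹ ⊗ ℂ = span_β D'_β`);
  `linearIndependent_sum_monB_pairIdxN`; `IsWeilTypeCM.cmDeg_eq` (`#Φ = e₀`);
  **`IsWeilTypeCM.finrank_hodgeClassSpan_one_eq_of_hodgeGroupSU`** (`dim_ℂ B¹ ⊗ ℂ = e₀`),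
  `IsWeilTypeCM.finrank_divisorClassesSpan_one_eq_of_hodgeGroupSU` (`dim_ℂ D¹ ⊗ ℂ = e₀`), and the isogeny class.

## References

* [vanGeemen1994HodgeAV] B. van Geemen, *An introduction to the Hodge conjecture for abelian varieties*, LNM 1594 (1994),
  6.9, Lemma 6.10, Thm. 6.12 and its proof («dim B¹(X) = 1»; the `SL`-invariants in `⋀•(W ⊕ W^*)`).
* [Deligne1982HodgeCycles] P. Deligne (notes by J. S. Milne), LNM 900 (1982), §4 (4.4) and p. 32
  (`H¹_B(A) ⊗ ℂ ≅ ⊕_σ H¹_{B,σ}`); Milne's 2003 re-edition, endnote 16.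
* [Milne2025AbelianMotivesCharP] J. S. Milne, arXiv:2508.09972, §1.5 Example 1.17 (`L(A) = GU(φ)` for general `(A, ν, λ)`).
* [MumfordAV1970] D. Mumford, *Abelian Varieties* (1970), §21 Application III (`NS(X) ⊗ ℚ` = symmetric elements of
  `End⁰(X)` for the Rosati involution).
* [LangeBirkenhake1992] H. Lange, Ch. Birkenhake, *Complex Abelian Varieties* (1992), Prop. 5.2.1, Lemma 1.1.17.
-/

noncomputable section

open CategoryTheory Polynomial Module
open Literature.AlgebraicTopology.SingularHomology
open Literature.AlgebraicGeometry.Motives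
open Literature.AlgebraicGeometry.HodgeTheory
open Literature.AlgebraicGeometry.VanGeemen1994
open Literature.AlgebraicGeometry.Milne1999
open Literature.Barriers.HodgeConjecture (divisorMonomials divisorClassesSpan)

namespace Literature.AlgebraicGeometry.Deligne1982

variable {A : AbelianVariety ℂ} {η : A ⟶ A} {R : Polynomial ℤ} {e₀ k : ℕ} {h : complexBetti A.X 2}

/-! ### §1 The signed block transposition on Weil vectors and pair monomials -/

section Swap

variable (hW : IsWeilTypeCM A η R e₀ k) (hpol : IsPolarizationClass A.dim A.X h) (hRos : IsRosatiCM A η h)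

/-- `⋀¹u = u`. [folklore] -/
private theorem extAct_one_apply' (u : complexBetti A.X 1 →ₗ[ℂ] complexBetti A.X 1) (v : complexBetti A.X 1) :
    extAct u 1 v = u v := by
  have e := extAct_cupPowOne u 1 (fun _ => v)
  rwa [cupPowOne_one, cupPowOne_one] at e

/-- A block-monomial automorphism on a Weil vector: `u (b_p) = c_{π p} b_{π p}`. [cite: vanGeemen1994HodgeAV, Lemma 6.10] -/
private theorem monoAutoCM_weilVec' (π : Equiv.Perm (Fin (cmDeg R) × (Fin (2 * k) × Fin 2)))
    (c : Fin (cmDeg R) × (Fin (2 * k) × Fin 2) → ℂˣ) (p : Fin (cmDeg R) × (Fin (2 * k) × Fin 2)) :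
    monoAutoCM hW hpol hRos π c (weilVec hW hpol hRos p) = (c (π p) : ℂ) • weilVec hW hpol hRos (π p) := by
  have e : ∀ q, weilVec hW hpol hRos q = weilBasisι hW hpol hRos q := fun q => (Module.Basis.mk_apply _ _ q).symm
  rw [e, e, monoAutoCM, Module.Basis.equiv_apply, Module.Basis.unitsSMul_apply, Units.smul_def]

omit hW hpol hRos in
/-- `blockPermCM β σ` on the block `β`. [folklore] -/
private theorem blockPermCM_apply_same (β : Fin (cmDeg R)) (σ : Equiv.Perm (Fin (2 * k))) (i : Fin (2 * k)) (s : Fin 2) :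
    blockPermCM β σ (β, i, s) = (β, σ i, s) := by
  rw [blockPermCM, Equiv.prodCongrRight_apply]
  simp

omit hW hpol hRos in
/-- `blockPermCM β σ` off the block `β`. [folklore] -/
private theorem blockPermCM_apply_ne {β β' : Fin (cmDeg R)} (hne : β' ≠ β) (σ : Equiv.Perm (Fin (2 * k)))
    (i : Fin (2 * k)) (s : Fin 2) : blockPermCM β σ (β', i, s) = (β', i, s) := by
  rw [blockPermCM, Equiv.prodCongrRight_apply]
  simp [hne]

/-- **`swap_{x,y} (w^β_x) = w^β_y`** (and the same on `w*`), for `x ≠ y`. [cite: vanGeemen1994HodgeAV, Lemma 6.10 and proof of Thm. 6.12] -/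
theorem swapCM_weilVec_left (β : Fin (cmDeg R)) {x y : Fin (2 * k)} (hxy : x ≠ y) (σ : Fin 2) :
    swapCM hW hpol hRos β x y (weilVec hW hpol hRos (β, x, σ)) = weilVec hW hpol hRos (β, y, σ) := by
  rw [swapCM, monoAutoCM_weilVec', blockPermCM_apply_same, Equiv.swap_apply_left]
  simp [swapUnitsCM, hxy.symm]

/-- **`swap_{x,y} (w^β_y) = -w^β_x`** (and the same on `w*`; the sign makes the determinant one).
[cite: vanGeemen1994HodgeAV, Lemma 6.10 and proof of Thm. 6.12] -/
theorem swapCM_weilVec_right (β : Fin (cmDeg R)) (x y : Fin (2 * k)) (σ : Fin 2) :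
    swapCM hW hpol hRos β x y (weilVec hW hpol hRos (β, y, σ)) = -weilVec hW hpol hRos (β, x, σ) := by
  rw [swapCM, monoAutoCM_weilVec', blockPermCM_apply_same, Equiv.swap_apply_right]
  simp [swapUnitsCM]

/-- `swap_{x,y}` fixes the other Weil vectors of the block. [cite: vanGeemen1994HodgeAV, Lemma 6.10] -/
theorem swapCM_weilVec_of_ne (β : Fin (cmDeg R)) {x y i : Fin (2 * k)} (hix : i ≠ x) (hiy : i ≠ y) (σ : Fin 2) :
    swapCM hW hpol hRos β x y (weilVec hW hpol hRos (β, i, σ)) = weilVec hW hpol hRos (β, i, σ) := by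
  rw [swapCM, monoAutoCM_weilVec', blockPermCM_apply_same, Equiv.swap_apply_of_ne_of_ne hix hiy]
  simp [swapUnitsCM, hix]

/-- `swap_{x,y}` of block `β` fixes the Weil vectors of the other blocks. [cite: vanGeemen1994HodgeAV, Lemma 6.10] -/
theorem swapCM_weilVec_of_block_ne {β β' : Fin (cmDeg R)} (hne : β' ≠ β) (x y i : Fin (2 * k)) (σ : Fin 2) :
    swapCM hW hpol hRos β x y (weilVec hW hpol hRos (β', i, σ)) = weilVec hW hpol hRos (β', i, σ) := by
  rw [swapCM, monoAutoCM_weilVec', blockPermCM_apply_ne hne]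
  simp [swapUnitsCM, hne]

/-- The pair monomial as a cup product in degree `2 · 1`. [cite: vanGeemen1994HodgeAV, proof of Thm. 6.12] -/
private theorem monB_pairIdxN' (β : Fin (cmDeg R)) (i : Fin (2 * k)) :
    monB (weilBasisN hW hpol hRos) (2 * 1) (pairIdxN β i) =
      cupProduct (show 1 + 1 = 2 * 1 from rfl) (weilVec hW hpol hRos (β, i, 0)) (weilVec hW hpol hRos (β, i, 1)) :=
  monB_pairIdxN hW hpol hRos β i

/-- `⋀²u (v ⌣ v') = u v ⌣ u v'`. [cite: HatcherAT2002, §3.2 Prop. 3.10] -/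
private theorem extAct_two_cupProduct (u : complexBetti A.X 1 →ₗ[ℂ] complexBetti A.X 1) (v v' : complexBetti A.X 1) :
    extAct u (2 * 1) (cupProduct (show 1 + 1 = 2 * 1 from rfl) v v') =
      cupProduct (show 1 + 1 = 2 * 1 from rfl) (u v) (u v') := by
  have h1 := exteriorPullback_cupProduct (hasExteriorCohomologyH1 A) u (show 1 + 1 = 2 * 1 from rfl) v v'
  have h2 : ∀ w, exteriorPullback (hasExteriorCohomologyH1 A) u 1 w = u w := extAct_one_apply' u
  rw [h2, h2] at h1
  exact h1

/-- **The signed transposition permutes the pair monomials**: `⋀²swap_{x,y} (w^{β'}_i ∧ w*^{β'}_i) = w^{β'}_j ∧ w*^{β'}_j`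
with `j = (x y)(i)` in block `β' = β` and `j = i` otherwise — no sign (the two signs cancel).
[cite: vanGeemen1994HodgeAV, Lemma 6.10 and proof of Thm. 6.12] -/
theorem extAct_swapCM_monB_pairIdxN (β : Fin (cmDeg R)) {x y : Fin (2 * k)} (hxy : x ≠ y) (β' : Fin (cmDeg R))
    (i : Fin (2 * k)) :
    extAct (swapCM hW hpol hRos β x y : complexBetti A.X 1 →ₗ[ℂ] complexBetti A.X 1) (2 * 1)
        (monB (weilBasisN hW hpol hRos) (2 * 1) (pairIdxN β' i)) =
      monB (weilBasisN hW hpol hRos) (2 * 1) (pairIdxN β' (if β' = β then Equiv.swap x y i else i)) := by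
  rw [monB_pairIdxN', monB_pairIdxN', extAct_two_cupProduct, LinearEquiv.coe_coe]
  by_cases hβ : β' = β
  · subst hβ
    rw [if_pos rfl]
    by_cases hix : i = x
    · subst hix
      rw [swapCM_weilVec_left hW hpol hRos β' hxy, swapCM_weilVec_left hW hpol hRos β' hxy, Equiv.swap_apply_left]
    · by_cases hiy : i = y
      · subst hiy
        rw [swapCM_weilVec_right hW hpol hRos β' x i, swapCM_weilVec_right hW hpol hRos β' x i,
          Equiv.swap_apply_right, LinearMap.map_neg₂, map_neg, neg_neg]
      · rw [swapCM_weilVec_of_ne hW hpol hRos β' hix hiy, swapCM_weilVec_of_ne hW hpol hRos β' hix hiy,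
          Equiv.swap_apply_of_ne_of_ne hix hiy]
  · rw [if_neg hβ, swapCM_weilVec_of_block_ne hW hpol hRos hβ, swapCM_weilVec_of_block_ne hW hpol hRos hβ]

omit hW hpol hRos in
/-- The pair monomial index sets are jointly injective in `(β, i)`. [folklore] -/
private theorem pairIdxN_inj {β β' : Fin (cmDeg R)} {i i' : Fin (2 * k)} (hij : pairIdxN (R := R) β i = pairIdxN β' i') :
    β = β' ∧ i = i' := by
  have hval : Ix R k (β, i, 0) ∈ (pairIdxN (R := R) β' i').val := by
    rw [← hij, pairIdxN, Set.powersetCard.val_ofCard, pairFin]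
    exact Finset.mem_insert_self _ _
  rw [pairIdxN, Set.powersetCard.val_ofCard, pairFin, Finset.mem_insert, Finset.mem_singleton] at hval
  rcases hval with h0 | h1
  · have := (Ix R k).injective h0
    simp only [Prod.mk.injEq] at this
    exact ⟨this.1, this.2.1⟩
  · have := (Ix R k).injective h1
    simp only [Prod.mk.injEq] at this
    exact absurd this.2.2 (by decide)

end Swap

/-- `c · 1 = c` in `ℂ` (a typed instance of `mul_one`, so that rewriting does not touch degree indices). [folklore] -/
private theorem mul_one_complex (c : ℂ) : c * 1 = c := mul_one c

/-! ### §2 Pair coefficients of degree-two Hodge classes are constant in each block -/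

section PairCoefficients

variable (hW : IsWeilTypeCM A η R e₀ k) (hpol : IsPolarizationClass A.dim A.X h) (hRos : IsRosatiCM A η h)

/-- **The pair coefficients of a class of `B¹ ⊗ ℂ` are constant in each block** (`k ≥ 2`, `Hg(A) = SU(φ)`):
`a_{β,i} = a_{β,j}` — the class is fixed by the signed transposition `swap_{i,j} ∈ SU(φ)(ℂ)` (tree
`extAct_swapCM_of_mem`), which permutes the pair monomials; only pair monomials carry coefficients (tree
`IsWeilTypeCM.repr_eq_zero_of_mem_hodgeClassSpan_one_of_two_le`). [cite: vanGeemen1994HodgeAV, Lemma 6.10 and proof of Thm. 6.12]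
[cite: Deligne1982HodgeCycles, Milne 2003 re-edition endnote 16] -/
theorem IsWeilTypeCM.repr_pairIdxN_eq_of_mem_hodgeClassSpan_one (hk : 2 ≤ k) (hSU : HasHodgeGroupSUCM A η (R.comp (X ^ 2)) h)
    {x : complexBetti A.X (2 * 1)} (hx : x ∈ hodgeClassSpan A.dim A.X 1) (β : Fin (cmDeg R)) (i j : Fin (2 * k)) :
    (monB (weilBasisN hW hpol hRos) (2 * 1)).repr x (pairIdxN β i) =
      (monB (weilBasisN hW hpol hRos) (2 * 1)).repr x (pairIdxN β j) := by
  classical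
  by_cases hij : i = j
  · rw [hij]
  set B := monB (weilBasisN hW hpol hRos) (2 * 1) with hB
  set u : complexBetti A.X 1 →ₗ[ℂ] complexBetti A.X 1 := (swapCM hW hpol hRos β i j : complexBetti A.X 1 →ₗ[ℂ] complexBetti A.X 1)
    with hu
  have hfix : extAct u (2 * 1) x = x := extAct_swapCM_of_mem hW hpol hRos hSU hx β hij
  -- expand `x` in the monomial basis and apply `⋀²u`
  have hexp : extAct u (2 * 1) x = ∑ s, B.repr x s • extAct u (2 * 1) (B s) := by
    conv_lhs => rw [← B.sum_repr x]
    rw [map_sum]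
    simp_rw [map_smul]
  -- read off the coefficient at the pair `(β, j)`
  have hcoef : B.repr (extAct u (2 * 1) x) (pairIdxN β j) = B.repr x (pairIdxN β i) := by
    rw [hexp, map_sum, Finset.sum_apply']
    simp_rw [map_smul, Finsupp.smul_apply, smul_eq_mul]
    rw [Finset.sum_eq_single (pairIdxN β i)]
    · rw [hB, extAct_swapCM_monB_pairIdxN hW hpol hRos β hij β i, if_pos rfl, Equiv.swap_apply_left,
        Module.Basis.repr_self, Finsupp.single_eq_same, mul_one_complex]
    · intro s _ hs
      by_cases hp : ∃ β' i', s = pairIdxN β' i'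
      · obtain ⟨β', i', rfl⟩ := hp
        rw [hB, extAct_swapCM_monB_pairIdxN hW hpol hRos β hij β' i', Module.Basis.repr_self, Finsupp.single_apply,
          if_neg, mul_zero]
        intro heq
        obtain ⟨hb, hi⟩ := pairIdxN_inj heq
        rw [if_pos hb] at hi
        have hi' : i' = i := by
          have := congrArg (Equiv.swap i j) hi
          rwa [Equiv.swap_apply_self, Equiv.swap_apply_right] at this
        exact hs (by rw [hb, hi'])
      · push Not at hp
        rw [hB, hW.repr_eq_zero_of_mem_hodgeClassSpan_one_of_two_le hpol hRos hk hSU hx s hp, zero_mul]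
    · intro hni; exact absurd (Finset.mem_univ _) hni
  rw [hfix] at hcoef
  exact hcoef.symm

/-- **`x = Σ_β a_β D'_β`**, `D'_β = Σᵢ w^β_i ∧ w*^β_i`, `a_β = a_{β,0}`, for every `x ∈ B¹ ⊗ ℂ` (`k ≥ 2`, `Hg(A) = SU(φ)`).
[cite: vanGeemen1994HodgeAV, proof of Thm. 6.12] [cite: Deligne1982HodgeCycles, §4 p. 32 and Milne 2003 re-edition endnote 16] -/
theorem IsWeilTypeCM.eq_sum_smul_sum_monB_pairIdxN (hk : 2 ≤ k) (hSU : HasHodgeGroupSUCM A η (R.comp (X ^ 2)) h)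
    {x : complexBetti A.X (2 * 1)} (hx : x ∈ hodgeClassSpan A.dim A.X 1) :
    x = ∑ β : Fin (cmDeg R), (monB (weilBasisN hW hpol hRos) (2 * 1)).repr x (pairIdxN β ⟨0, by omega⟩) •
      ∑ i : Fin (2 * k), monB (weilBasisN hW hpol hRos) (2 * 1) (pairIdxN β i) := by
  classical
  -- both sides have the same coordinates
  refine (monB (weilBasisN hW hpol hRos) (2 * 1)).ext_elem fun t => ?_
  simp only [map_sum, map_smul, Finset.sum_apply', Finsupp.smul_apply, Module.Basis.repr_self, smul_eq_mul,
    Finsupp.single_apply]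
  by_cases hp : ∃ β i, t = pairIdxN β i
  · obtain ⟨β, i, rfl⟩ := hp
    rw [Finset.sum_eq_single β]
    · rw [Finset.sum_eq_single i]
      · rw [if_pos rfl, mul_one_complex]
        exact hW.repr_pairIdxN_eq_of_mem_hodgeClassSpan_one hpol hRos hk hSU hx β i _
      · intro i' _ hi'
        rw [if_neg]
        exact fun heq => hi' (pairIdxN_inj heq).2
      · intro hni; exact absurd (Finset.mem_univ _) hni
    · intro β' _ hβ'
      rw [Finset.sum_eq_zero, mul_zero]
      intro i' _
      rw [if_neg]
      exact fun heq => hβ' (pairIdxN_inj heq).1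
    · intro hni; exact absurd (Finset.mem_univ _) hni
  · push Not at hp
    rw [hW.repr_eq_zero_of_mem_hodgeClassSpan_one_of_two_le hpol hRos hk hSU hx t hp]
    symm
    refine Finset.sum_eq_zero fun β _ => ?_
    rw [Finset.sum_eq_zero, mul_zero]
    intro i _
    rw [if_neg]
    exact fun heq => hp β i heq.symm

/-- **`B¹ ⊗ ℂ ⊆ span_β {D'_β}`** (`k ≥ 2`, `Hg(A) = SU(φ)`): the `SU(φ)(ℂ)`-invariants of `⋀² H¹` are spanned by the
pairings `D'_β = Σᵢ w^β_i ∧ w*^β_i`. [cite: vanGeemen1994HodgeAV, proof of Thm. 6.12] [cite: Deligne1982HodgeCycles, Milne 2003 re-edition endnote 16] -/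
theorem IsWeilTypeCM.hodgeClassSpan_one_le_span_sum_monB_pairIdxN (hk : 2 ≤ k)
    (hSU : HasHodgeGroupSUCM A η (R.comp (X ^ 2)) h) :
    hodgeClassSpan A.dim A.X 1 ≤ Submodule.span ℂ (Set.range fun β : Fin (cmDeg R) =>
      ∑ i : Fin (2 * k), monB (weilBasisN hW hpol hRos) (2 * 1) (pairIdxN β i)) := by
  intro x hx
  rw [hW.eq_sum_smul_sum_monB_pairIdxN hpol hRos hk hSU hx]
  exact Submodule.sum_mem _ fun β _ => Submodule.smul_mem _ _ (Submodule.subset_span ⟨β, rfl⟩)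

end PairCoefficients

/-! ### §3 `B¹ ⊗ ℂ = ⊕_β ℂ · D'_β` and the Picard number `e₀ = [F:ℚ]` -/

section PicardNumber

variable (hW : IsWeilTypeCM A η R e₀ k) (hpol : IsPolarizationClass A.dim A.X h) (hRos : IsRosatiCM A η h)

/-- **`D'_β ∈ B¹ ⊗ ℂ`** (`k ≥ 2`, `Hg(A) = SU(φ)`): the paired part `D'_β(h) = Σᵢ α_{β,i} w^β_i ∧ w*^β_i` of the polarization
class is a Hodge class (tree `pairPart_mem_hodgeClassSpan`) with all `α_{β,i} = α_β ≠ 0` (§2 and tree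
`repr_pairIdxN_ne_zero`), and `D'_β = α_β⁻¹ · D'_β(h)`. [cite: vanGeemen1994HodgeAV, proof of Thm. 6.12]
[cite: Deligne1982HodgeCycles, Milne 2003 re-edition endnote 16] -/
theorem IsWeilTypeCM.sum_monB_pairIdxN_mem_hodgeClassSpan_one (hk : 2 ≤ k) (hSU : HasHodgeGroupSUCM A η (R.comp (X ^ 2)) h)
    (β : Fin (cmDeg R)) :
    ∑ i : Fin (2 * k), monB (weilBasisN hW hpol hRos) (2 * 1) (pairIdxN β i) ∈ hodgeClassSpan A.dim A.X 1 := by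
  have hh : h ∈ hodgeClassSpan A.dim A.X 1 := mem_hodgeClassSpan_one_of_isPolarizationClass hW hpol
  set i₀ : Fin (2 * k) := ⟨0, by omega⟩
  set α : ℂ := (monB (weilBasisN hW hpol hRos) (2 * 1)).repr h (pairIdxN β i₀) with hα
  have hα0 : α ≠ 0 := repr_pairIdxN_ne_zero hW hpol hRos hSU β i₀
  have hpart : pairPart hW hpol hRos β h = α • ∑ i : Fin (2 * k), monB (weilBasisN hW hpol hRos) (2 * 1) (pairIdxN β i) := by
    rw [pairPart, Finset.smul_sum]
    refine Finset.sum_congr rfl fun i _ => ?_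
    rw [hW.repr_pairIdxN_eq_of_mem_hodgeClassSpan_one hpol hRos hk hSU hh β i i₀]
  have hmem := Submodule.smul_mem _ α⁻¹ (pairPart_mem_hodgeClassSpan hW hpol hRos hSU hh β)
  rwa [hpart, smul_smul, inv_mul_cancel₀ hα0, one_smul] at hmem

/-- **`B¹ ⊗ ℂ = span_β {D'_β}`** for the general CM-Weil abelian variety (`k ≥ 2`).
[cite: vanGeemen1994HodgeAV, Thm. 6.12 and its proof] [cite: Deligne1982HodgeCycles, Milne 2003 re-edition endnote 16] -/
theorem IsWeilTypeCM.hodgeClassSpan_one_eq_span_sum_monB_pairIdxN (hk : 2 ≤ k)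
    (hSU : HasHodgeGroupSUCM A η (R.comp (X ^ 2)) h) :
    hodgeClassSpan A.dim A.X 1 = Submodule.span ℂ (Set.range fun β : Fin (cmDeg R) =>
      ∑ i : Fin (2 * k), monB (weilBasisN hW hpol hRos) (2 * 1) (pairIdxN β i)) :=
  le_antisymm (hW.hodgeClassSpan_one_le_span_sum_monB_pairIdxN hpol hRos hk hSU)
    (Submodule.span_le.2 (by
      rintro _ ⟨β, rfl⟩
      exact hW.sum_monB_pairIdxN_mem_hodgeClassSpan_one hpol hRos hk hSU β))

/-- **The pairings `D'_β` are linearly independent** (their supports — the pair monomials of block `β` — are disjoint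
parts of the monomial basis). [cite: vanGeemen1994HodgeAV, proof of Thm. 6.12] [cite: LangeBirkenhake1992, Lemma 1.1.17] -/
theorem linearIndependent_sum_monB_pairIdxN :
    LinearIndependent ℂ (fun β : Fin (cmDeg R) => ∑ i : Fin (2 * k), monB (weilBasisN hW hpol hRos) (2 * 1) (pairIdxN β i)) := by
  classical
  have hk := hW.k_pos
  set B := monB (weilBasisN hW hpol hRos) (2 * 1) with hB
  set i₀ : Fin (2 * k) := ⟨0, by omega⟩
  rw [Fintype.linearIndependent_iff]
  intro g hg β₀
  -- the coefficient of `Σ_β g β • D'_β` at the pair monomial `(β₀, i₀)` is `g β₀`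
  have hc := congrArg (fun z => B.repr z (pairIdxN β₀ i₀)) hg
  simp only [map_sum, map_smul, map_zero, Finset.sum_apply', Finsupp.smul_apply, Finsupp.coe_zero, Pi.zero_apply,
    hB, Module.Basis.repr_self, smul_eq_mul, Finsupp.single_apply] at hc
  rw [Finset.sum_eq_single β₀] at hc
  · rw [Finset.sum_eq_single i₀] at hc
    · rwa [if_pos rfl, mul_one_complex] at hc
    · intro i' _ hi'
      rw [if_neg]
      exact fun heq => hi' (pairIdxN_inj heq).2
    · intro hni; exact absurd (Finset.mem_univ _) hni
  · intro β' _ hβ'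
    rw [Finset.sum_eq_zero, mul_zero]
    intro i' _
    rw [if_neg]
    exact fun heq => hβ' (pairIdxN_inj heq).1
  · intro hni; exact absurd (Finset.mem_univ _) hni

include hW hpol hRos in
/-- **`#Φ = e₀`**: the CM type has `e₀ = [F:ℚ]` elements (the Weil basis has `#Φ · 2k · 2 = 2 dim A = 4 k e₀` vectors,
tree `IsWeilTypeCM.nIdx_eq`). [cite: Deligne1982HodgeCycles, §4 p. 30 and p. 32 (d[E:ℚ] = 2 dim A)] -/
theorem IsWeilTypeCM.cmDeg_eq : cmDeg R = e₀ := by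
  have h1 := hW.nIdx_eq hpol hRos
  rw [NIdx, hW.dim_eq] at h1
  have hk := hW.k_pos
  have h2 : cmDeg R * (2 * k * 2) = e₀ * (2 * k * 2) := by rw [h1]; ring
  exact Nat.eq_of_mul_eq_mul_right (by positivity) h2

include hW hpol hRos in
/-- **`dim_ℂ B¹ ⊗ ℂ = e₀ = [F:ℚ]`: the Picard number of the general CM-Weil abelian variety** (`k ≥ 2`) is the degree of
the totally real subfield `F` of `E` (van Geemen's «`dim B¹(X) = 1`» for `E` imaginary quadratic; `NS(A) ⊗ ℚ ≅ F`, the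
Rosati-symmetric part of `End⁰(A) = E`). [cite: vanGeemen1994HodgeAV, Thm. 6.12 and its proof]
[cite: Deligne1982HodgeCycles, Milne 2003 re-edition endnote 16] [cite: MumfordAV1970, §21 Application III]
[cite: Milne2025AbelianMotivesCharP, §1.5 Example 1.17] -/
theorem IsWeilTypeCM.finrank_hodgeClassSpan_one_eq_of_hodgeGroupSU (hk : 2 ≤ k)
    (hSU : HasHodgeGroupSUCM A η (R.comp (X ^ 2)) h) : finrank ℂ (hodgeClassSpan A.dim A.X 1) = e₀ := by
  rw [hW.hodgeClassSpan_one_eq_span_sum_monB_pairIdxN hpol hRos hk hSU,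
    finrank_span_eq_card (linearIndependent_sum_monB_pairIdxN hW hpol hRos), Fintype.card_fin, hW.cmDeg_eq hpol hRos]

include hW hpol hRos in
/-- **`dim_ℂ D¹ ⊗ ℂ = e₀`** (`D¹ ⊗ ℂ = B¹ ⊗ ℂ`, tree `Milne1999.divisorClassesSpan_one_eq_hodgeClassSpan_one`).
[cite: vanGeemen1994HodgeAV, 2.4 and Thm. 6.12] [cite: MumfordAV1970, §21 Application III] -/
theorem IsWeilTypeCM.finrank_divisorClassesSpan_one_eq_of_hodgeGroupSU (hk : 2 ≤ k)
    (hSU : HasHodgeGroupSUCM A η (R.comp (X ^ 2)) h) : finrank ℂ (divisorClassesSpan A.X A.dim 1) = e₀ := by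
  rw [Milne1999.divisorClassesSpan_one_eq_hodgeClassSpan_one, hW.finrank_hodgeClassSpan_one_eq_of_hodgeGroupSU hpol hRos hk hSU]

/-- `ℂ`-basis form: **`(D'_β)_β` is a basis of `B¹ ⊗ ℂ`** — existence of a basis of `B¹ ⊗ ℂ` indexed by the CM type whose
members are the pairings. [cite: vanGeemen1994HodgeAV, proof of Thm. 6.12] [cite: Deligne1982HodgeCycles, §4 p. 32] -/
theorem IsWeilTypeCM.exists_basis_hodgeClassSpan_one_of_hodgeGroupSU (hk : 2 ≤ k)
    (hSU : HasHodgeGroupSUCM A η (R.comp (X ^ 2)) h) :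
    ∃ b : Module.Basis (Fin (cmDeg R)) ℂ (hodgeClassSpan A.dim A.X 1),
      ∀ β, (b β : complexBetti A.X (2 * 1)) = ∑ i : Fin (2 * k), monB (weilBasisN hW hpol hRos) (2 * 1) (pairIdxN β i) := by
  classical
  have hli := linearIndependent_sum_monB_pairIdxN hW hpol hRos
  have heq := hW.hodgeClassSpan_one_eq_span_sum_monB_pairIdxN hpol hRos hk hSU
  refine ⟨(Module.Basis.span hli).map (LinearEquiv.ofEq _ _ heq.symm), fun β => ?_⟩
  rw [Module.Basis.map_apply, LinearEquiv.coe_ofEq_apply, Module.Basis.span_apply]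

end PicardNumber

/-! ### §4 The isogeny class -/

section Isogeny

variable {C : AbelianVariety ℂ}

/-- **On the isogeny class, `dim_ℂ B¹ ⊗ ℂ = e₀`** (`dim_ℂ B¹ ⊗ ℂ` is an isogeny invariant, tree
`hodgeClassSpan_map_eq_of_isIsogeny`). [cite: vanGeemen1994HodgeAV, 3.6 (p. 236) and Thm. 6.12] -/
theorem finrank_hodgeClassSpan_one_eq_of_isIsogenous_of_hasHodgeGroupSUCM (hW : IsWeilTypeCM A η R e₀ k)
    (hpol : IsPolarizationClass A.dim A.X h) (hRos : IsRosatiCM A η h) (hk : 2 ≤ k)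
    (hSU : HasHodgeGroupSUCM A η (R.comp (X ^ 2)) h) (hC : AbelianVariety.IsIsogenous C A) :
    finrank ℂ (hodgeClassSpan C.dim C.X 1) = e₀ := by
  obtain ⟨g, hg⟩ := hC
  have hB := (Submodule.equivMapOfInjective _ (complexBetti_map_bijective_of_isIsogeny hg (2 * 1)).1
    (hodgeClassSpan A.dim A.X 1)).finrank_eq
  rw [hodgeClassSpan_map_eq_of_isIsogeny hg 1] at hB
  rw [← hB]
  exact hW.finrank_hodgeClassSpan_one_eq_of_hodgeGroupSU hpol hRos hk hSU

/-- **On the isogeny class, `dim_ℂ D¹ ⊗ ℂ = e₀`.** [cite: vanGeemen1994HodgeAV, 2.4, 3.6 (p. 236) and Thm. 6.12] -/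
theorem finrank_divisorClassesSpan_one_eq_of_isIsogenous_of_hasHodgeGroupSUCM (hW : IsWeilTypeCM A η R e₀ k)
    (hpol : IsPolarizationClass A.dim A.X h) (hRos : IsRosatiCM A η h) (hk : 2 ≤ k)
    (hSU : HasHodgeGroupSUCM A η (R.comp (X ^ 2)) h) (hC : AbelianVariety.IsIsogenous C A) :
    finrank ℂ (divisorClassesSpan C.X C.dim 1) = e₀ := by
  rw [Milne1999.divisorClassesSpan_one_eq_hodgeClassSpan_one,
    finrank_hodgeClassSpan_one_eq_of_isIsogenous_of_hasHodgeGroupSUCM hW hpol hRos hk hSU hC]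

end Isogeny

end Literature.AlgebraicGeometry.Deligne1982

end
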